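import Summits.NavierStokesRegularity.NavierStokesRegularity.Theorems.CircuitPump.Negative.ScalarSign
import Summits.NavierStokesRegularity.NavierStokesRegularity.Theorems.CircuitPump.Negative.CriticalBoundRoundOne

/-!
# Disproof of `CircuitPump` (stmt-NavierStokesRegularity-1834) — standing adversary's work file

cdisprove seats `refuter-cdisprove-stmt-NavierStokesRegularity-1834-0` (cycle 1, 2026-08-16) and
`refuter-cdisprove-stmt-NavierStokesRegularity-1834-g2-0` (cycle 2, 2026-08-16, this version v3).
`lean check` rc 0; `sorry` only in §(e) (one stub whose proof IS in the tree but whose module could not be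
imported this cycle, and the conjectural sub-questions). Since cycle 1 the Negative lane
`Theorems/CircuitPump/Negative/` holds the sorry-free versions of §(0), (a1)–(a3), (b1)–(b4), (e1), (e2):
`LoadBearing.lean`, `WitnessStructure.lean`, `CriticalBoundRoundOne.lean`, `CriticalBound.lean`, `ScalarSign.lean`
(namespace `Theorems.CircuitPumpNegative`, imported and re-exported here — this file no longer carries copies).

## Findings (index)

* (0) `circuitPump_iff` [LoadBearing] — the crux is `Wrap IsPump` definitionally (named clauses `IsSym`, `IsCyc`,
  `SolvesODE`, `IsDSS`, `IsTypeI`, `IsNontrivial`); every lemma below is about the crux verbatim.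
* (a) LOAD-BEARING ANALYSIS (the crux is EXISTENTIAL, so a clause is load-bearing iff the crux with that clause
  deleted is trivially TRUE). [LoadBearing] `withoutTypeI_holds` (free viscous decay, `coeff = 0`),
  `withoutODE_holds` (saturated Type-I power), `withoutNontrivial_holds` (`X = 0`): ALL the difficulty sits in
  ODE ∧ Type-I ∧ nontrivial; DSS and the algebra are free.
  **NEW (a4, cycle 2, this file §(a4) and `Negative/NonConservativePump.lean` proposed): ENERGY CONSERVATION IS
  LOAD-BEARING.** The analytic conjunction `SolvesODE ∧ IsDSS ∧ IsTypeI ∧ IsNontrivial` IS consistent inside Tao's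
  symmetric class once cyclic cancellation is dropped, in closed form: the feed-forward `m = 1` circuit
  `Ẋ_n = -lam^{4n/5}X_n + c lam^{n-1}X_{n-1}²` (`feedCoeff`, symmetric, `¬IsCyc`) has the exactly 1-DSS, Type-I
  (`C = 1`), ancient solution `X_n(t) = lam^{-n/5}exp(lam^{4n/5}t)` precisely when `lam^{4/5} = 2`
  (`nonConservativePump`, `withoutCycAbove_holds : WithoutCycAbove (2^{5/4})`). So ANY DISPROOF MUST USE `IsCyc`
  (or the fineness `lam < 2^{5/4}`). Whether `WithoutCycAbove 1` (fine lam, no energy conservation) holds is open,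
  but not by closed forms: see (g1).
  NOT settled: the crux without DSS (an ancient Type-I nontrivial solution of some conservative circuit) —
  conjecturally as hard as the crux.
* (b) STRUCTURE every witness must have. [WitnessStructure] `no_free_mode`, `steady_mode_trivial`,
  `dss_up`/`dss_down`/`nontrivial_propagates_up` (bi-infinite support: no finite truncation in scale is a witness;
  the pump is fed from `n = -∞`), `scalar_coeff_iff` + `scalar_rhs` (m = 1 ≡ the signed Katz–Pavlović/Cheskidov
  dyadic model at α = 2/5, one parameter `a`). [CriticalBoundRoundOne + CriticalBound] `round_one`,
  `typeI_critical_bound` (e1): Type I self-improves to `sup lam^{n/5}|X_{i,n}| < ∞` (finite residues, frozen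
  `1/|x|` trail). [ScalarSign] `scalar_nonneg` (e2): m = 1 witnesses are sign-definite.
  **NEW (b5, cycle 2, this file §(b5) and `Negative/SmallConstant.lean` proposed): THE SMALL-CONSTANT LIOUVILLE
  THEOREM — nontriviality is quantitative.** For every solution on `(-∞,0)` with Type-I constant `C` (no DSS, no
  energy conservation needed): `typeI_improve` — the constant self-improves QUADRATICALLY, `C ↦ κC²`,
  `κ = S_tot·lam^{1/5}`, `S_tot = Σ|coeff|`; `typeI_small_trivial` — if `κC < 1` the solution is identically zero;
  `typeI_const_lower_bound` — every nontrivial ancient Type-I solution, in particular every pump, has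
  `C ≥ lam^{-1/5}/S_tot`. (Mechanism: integrating factor + the explicit barrier `e^{aτ}log(1 + 1/(a(-τ)))` for the
  exponential integral + `log(1+x) ≤ √x`; the ODE twin of "ancient mild solutions with small `√(-t)‖u‖_∞` vanish".)
  This is the sharpest UNIVERSAL (circuit-independent) exclusion available: below the threshold `κC = 1` the
  linear dissipation wins at every scale; a pump lives at `κC ≥ 1`, where no abstract argument bites (see "Why the
  crux resists").
* (c) NATURAL STRENGTHENINGS refuted: steady witnesses (`steady_mode_trivial`), linear/free witnesses
  (`no_free_mode`), pure powers (three incompatible powers), small-amplitude witnesses (`typeI_small_trivial`),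
  CLOSED-FORM (finite exponential-sum / Dirichlet-type) witnesses at fine lam ((g1): impossible for
  `lam < 2^{5/4}` in ANY circuit of the class). No finite-model refutation applies (bi-infinite support; zero is
  strictly stable for every finite truncation; the pump is intrinsically infinite-dimensional).
* (d) TARGETS: the lead's picked line is `Lines/singular-clock-gspt.lean` (5 stubs: `stub_clockBox` [hardest,
  existential in the circuit], `stub_truncatedFlow`, `stub_clampCovering`, `stub_truncationLimit`,
  `stub_dssExtension`); payload `stuck_stubs`/`targets` are EMPTY this cycle; the drefute seat's report
  (`Cruxes/CircuitPump/SingularClockGsptDrefute.md`) re-derives C1/C2/D/E TRUE as typed and finds nothing against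
  `stub_clockBox` (numerics j012061/j013173: u = 1 covering with the affine clock on the m = 2 seeded Toda instance).
  Reading notes and the (small) consequences of (b5) for the line at the end of this file (§(d)).
* (e) NEAR-MISSES / OPEN SUB-QUESTIONS: (e1) stub pointing at the landed `CriticalBound.typeI_critical_bound`
  (sorried here only because the farm build of that module was stale when this version was published; the proof is
  in the tree); (e2) `scalar_nonneg` = the landed theorem (one line); (e3) `ScalarPumpAt`/`ScalarCircuitPump` — does
  the m = 1 chain pump at α = 2/5? (cycle-1 numerics: declocking continuation folds, no autonomous scalar profile
  found at q = 2, 1.5; transonic obstruction at fine lam; status unchanged, see §(f)).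
* (f) the scalar dossier (cycle 1), (g) NEW closed-form analysis and the conservative exponential design problem,
  "Why the crux resists" — below.

## Why the crux resists disproof (for the provers) — updated cycle 2

A disproof is an abstract ODE Liouville theorem over ALL Tao circuits (any `m`, any real structure constants) at
every fine `lam`: "no ancient, exactly-DSS, Type-I solution". Universal tools and where each stops:
(i) ENERGY: the energy of a pump is infinite (low modes carry `X_n ≈ L·lam^{-n/5}`, `n → -∞`); every convergent
weighted energy is flux-dominated at the low modes; the DSS rescaling is not energy-preserving
(`E(lam^{4k/5}t) = lam^{2k/5}E(t)`), so monotonicity of energy is consistent with an orbit emanating from `0` at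
`t = -∞`; the time-integrated flux through every interface is positive and finite (budget identity) — a
constraint, not a contradiction. (ii) LINEAR DOMINANCE: `typeI_small_trivial` (b5) is exactly the regime where
dissipation beats the quadratic forcing uniformly (`κC < 1`); at `κC ≥ 1` the comparison is lost at every scale
simultaneously (the estimate is scale-invariant, so there is no "first scale" to induct on). (iii) STABILITY OF 0:
zero is strictly stable for every finite truncation but the chain is not uniformly stable (rates
`lam^{4n/5} → 0` as `n → -∞`). (iv) WITHOUT ENERGY CONSERVATION A PUMP EXISTS (a4) — so a kill must be a genuinely
TRILINEAR/sign argument using `IsCyc`, i.e. fine structure of the circuit, which is the route's thesis in ODE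
form; for m = 1 such structure exists (positivity (e2), BMR's invariant region at `λ_BMR = 2`, the transonic
obstruction of §(f)), for m ≥ 2 none is known, and the panel's numerics (TRIAGE-r1-3 §Toy, drefute j012061/j013173)
exhibit exact-looking k = 1 DSS Type-I threshold orbits for the m = 2 seeded graded Toda circuit and for a Tao-type
m = 4 chain at lam = 2, 1.5, 1.25, 1.125. Assessment after two cycles: the crux is very probably TRUE; the
negative lane's value is the a-priori structure (b1)–(b5) it hands to the positive lines.
-/

set_option linter.dupNamespace false

noncomputable section

open scoped BigOperators
open Real Set

namespace Summit.NavierStokesRegularity.NavierStokesRegularity.Cruxes.CircuitPump.Disproof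

open Summit.NavierStokesRegularity.NavierStokesRegularity.Theorems.CircuitPumpNegative

/-! ## (0), (a1)–(a3), (b1)–(b4): landed in the Negative lane — re-exported here

The vocabulary and the cycle-1 theorems live in `Theorems.CircuitPumpNegative`; the `export` below makes them
available as `Disproof.<name>` as well, so references in older notes keep resolving. -/

export Summit.NavierStokesRegularity.NavierStokesRegularity.Theorems.CircuitPumpNegative (IsSym IsCyc rhsF
  SolvesODE IsDSS IsTypeI IsNontrivial Wrap IsPump circuitPump_iff WithoutTypeI WithoutODE WithoutNontrivial
  withoutTypeI_holds withoutODE_holds withoutNontrivial_holds freeX powX no_free_mode steady_mode_trivial dss_up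
  dss_down nontrivial_propagates_up scalarCoeff scalar_coeff_iff scalar_rhs round_one coeffSum)

/-! ## (a4) NEW: energy conservation is load-bearing — an explicit non-conservative pump at `lam = 2^{5/4}`

(Sorry-free; the same content is proposed for the tree as `Theorems/CircuitPump/Negative/NonConservativePump.lean`.)
The four analytic clauses `SolvesODE ∧ IsDSS ∧ IsTypeI ∧ IsNontrivial` are jointly satisfiable in Tao's SYMMETRIC
class as soon as cyclic cancellation is dropped and `lam^{4/5} = 2`: feed-forward circuit, exponential profile
decaying into the past. Hence any disproof of the crux must use `IsCyc` or the fineness of `lam`. -/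


/-- The crux with cyclic cancellation deleted and the fineness threshold `1` replaced by `l`:
`WithoutCycAbove 1` is literally `CircuitPump` minus `IsCyc`. -/
def WithoutCycAbove (l : ℝ) : Prop :=
  ∀ lam₀ : ℝ, l < lam₀ → ∃ lam : ℝ, 1 < lam ∧ lam < lam₀ ∧
    ∃ (m : ℕ) (coeff : Fin m → Fin m → Fin m → Option (Fin 3) → ℝ) (k : ℕ) (X : Fin m → ℤ → ℝ → ℝ),
      IsSym coeff ∧ 1 ≤ k ∧ SolvesODE lam coeff X ∧ IsDSS lam k X ∧ IsTypeI lam X ∧ IsNontrivial X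

/-- The feed-forward structure constants: only the offset label `(0,0,1)` (`some 2`) is on. -/
def feedCoeff (c : ℝ) : Fin 1 → Fin 1 → Fin 1 → Option (Fin 3) → ℝ :=
  fun _ _ _ μ => if μ = some 2 then c else 0

/-- The feed-forward circuit is Tao-symmetric (the swap of the first two offset coordinates fixes `(0,0,1)`). -/
theorem isSym_feedCoeff (c : ℝ) : IsSym (feedCoeff c) := by
  intro i₁ i₂ i₃ μ
  rcases μ with _ | j
  · simp [feedCoeff]
  · fin_cases j <;> simp [feedCoeff, Equiv.swap_apply_of_ne_of_ne]

/-- The feed-forward circuit is NOT cyclic-cancelling (it does not conserve energy): the cyclic sum at the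
label `(0,0,1)` is `2c`. -/
theorem not_isCyc_feedCoeff {c : ℝ} (hc : c ≠ 0) : ¬ IsCyc (feedCoeff c) := by
  intro h
  have := h (fun _ => 0) (some 2)
  rw [sum_perm_fin_three] at this
  have e0 : (Equiv.symm (1 : Equiv.Perm (Fin 3))) = 1 := by decide
  have e1 : (Equiv.swap (0 : Fin 3) 1 * Equiv.swap 1 2).symm = Equiv.swap 1 2 * Equiv.swap 0 1 := by decide
  have e2 : (Equiv.swap (1 : Fin 3) 2 * Equiv.swap 0 1).symm = Equiv.swap 0 1 * Equiv.swap 1 2 := by decide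
  simp [feedCoeff, Equiv.swap_apply_of_ne_of_ne, Equiv.swap_apply_right,
    Equiv.symm_swap, e0, e1, e2, Equiv.Perm.coe_one] at this
  exact hc (by linarith)

/-- The feed-forward right-hand side: `F_n = -lam^{4n/5}X_n + c·lam^{n-1}·X_{n-1}²`. -/
theorem feed_rhs (lam c : ℝ) (X : Fin 1 → ℤ → ℝ → ℝ) (n : ℤ) (t : ℝ) :
    rhsF lam (feedCoeff c) X 0 n t =
      -(lam ^ ((4 / 5 : ℝ) * n)) * X 0 n t + c * lam ^ ((n : ℝ) - 1) * X 0 (n - 1) t ^ 2 := by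
  simp only [rhsF, Fin.sum_univ_one, Fintype.sum_option, Fin.sum_univ_three]
  simp [feedCoeff, sub_eq_add_neg]
  ring

/-- THE PROFILE `X_n(t) = lam^{-n/5} exp(lam^{4n/5} t)` (decaying into the past). -/
def expX (lam : ℝ) : Fin 1 → ℤ → ℝ → ℝ :=
  fun _ n t => lam ^ (-((1 / 5 : ℝ) * n)) * Real.exp (lam ^ ((4 / 5 : ℝ) * n) * t)

/-- `Ẋ_n = lam^{4n/5} X_n` for the profile. -/
theorem expX_hasDerivAt (lam : ℝ) (i : Fin 1) (n : ℤ) (t : ℝ) :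
    HasDerivAt (expX lam i n) (lam ^ ((4 / 5 : ℝ) * n) * expX lam i n t) t := by
  have h1 : HasDerivAt (fun s : ℝ => lam ^ ((4 / 5 : ℝ) * n) * s) (lam ^ ((4 / 5 : ℝ) * n) * 1) t :=
    (hasDerivAt_id t).const_mul _
  have h2 := (h1.exp).const_mul (lam ^ (-((1 / 5 : ℝ) * n)))
  refine h2.congr_deriv ?_
  simp only [expX]
  ring

/-- `expX` is exactly 1-DSS, for every `lam > 0`. -/
theorem expX_dss {lam : ℝ} (hlam : 0 < lam) (i : Fin 1) (n : ℤ) (t : ℝ) :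
    expX lam i (n + (1 : ℕ)) (lam ^ (-((4 / 5 : ℝ) * (1 : ℕ))) * t) =
      lam ^ (-((1 / 5 : ℝ) * (1 : ℕ))) * expX lam i n t := by
  simp only [expX, Nat.cast_one, mul_one]
  have h1 : lam ^ ((4 / 5 : ℝ) * ((n + 1 : ℤ) : ℝ)) * (lam ^ (-(4 / 5 : ℝ)) * t) =
      lam ^ ((4 / 5 : ℝ) * (n : ℝ)) * t := by
    push_cast
    have : lam ^ ((4 / 5 : ℝ) * ((n : ℝ) + 1)) * lam ^ (-(4 / 5 : ℝ)) = lam ^ ((4 / 5 : ℝ) * (n : ℝ)) := by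
      rw [← Real.rpow_add hlam]; congr 1; ring
    calc lam ^ ((4 / 5 : ℝ) * ((n : ℝ) + 1)) * (lam ^ (-(4 / 5 : ℝ)) * t)
        = (lam ^ ((4 / 5 : ℝ) * ((n : ℝ) + 1)) * lam ^ (-(4 / 5 : ℝ))) * t := by ring
      _ = lam ^ ((4 / 5 : ℝ) * (n : ℝ)) * t := by rw [this]
  have h2 : lam ^ (-((1 / 5 : ℝ) * ((n + 1 : ℤ) : ℝ))) =
      lam ^ (-(1 / 5 : ℝ)) * lam ^ (-((1 / 5 : ℝ) * (n : ℝ))) := by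
    push_cast
    rw [← Real.rpow_add hlam]; congr 1; ring
  rw [h1, h2]
  ring

/-- `expX` is Type I with constant `1`, for every `lam > 0` (`√s·e^{-s} ≤ 1`). -/
theorem expX_typeI {lam : ℝ} (hlam : 0 < lam) (i : Fin 1) (n : ℤ) (t : ℝ) (ht : t < 0) :
    lam ^ ((3 / 5 : ℝ) * n) * |expX lam i n t| ≤ 1 / Real.sqrt (-t) := by
  have hnt : 0 < -t := by linarith
  set a : ℝ := lam ^ ((4 / 5 : ℝ) * n) with ha
  have hapos : 0 < a := Real.rpow_pos_of_pos hlam _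
  have hsq : 0 < Real.sqrt (-t) := Real.sqrt_pos.2 hnt
  simp only [expX]
  rw [abs_mul, abs_of_pos (Real.rpow_pos_of_pos hlam _), abs_of_pos (Real.exp_pos _), ← ha]
  rw [le_div_iff₀ hsq, ← mul_assoc, ← Real.rpow_add hlam]
  have hexp2 : (3 / 5 : ℝ) * n + -((1 / 5 : ℝ) * n) = ((4 / 5 : ℝ) * n) * (1 / 2 : ℝ) := by ring
  rw [hexp2, Real.rpow_mul hlam.le, ← ha, ← Real.sqrt_eq_rpow]
  -- √a · e^{a t} · √(-t) ≤ 1, i.e. √s e^{-s} ≤ 1 with s = a(-t)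
  have hs : Real.sqrt a * Real.sqrt (-t) = Real.sqrt (a * -t) := (Real.sqrt_mul hapos.le _).symm
  have hspos : 0 < a * -t := mul_pos hapos hnt
  have h1 : Real.sqrt (a * -t) ≤ 1 + a * -t := by
    rw [show (1 : ℝ) + a * -t = Real.sqrt ((1 + a * -t) ^ 2) by
      rw [Real.sqrt_sq (by positivity)]]
    apply Real.sqrt_le_sqrt; nlinarith
  have h2 : 1 + a * -t ≤ Real.exp (a * -t) := by
    have := Real.add_one_le_exp (a * -t); linarith
  have h3 : Real.exp (a * t) * Real.exp (a * -t) = 1 := by rw [← Real.exp_add]; simp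
  have hE : 0 < Real.exp (a * t) := Real.exp_pos _
  calc Real.sqrt a * Real.exp (a * t) * Real.sqrt (-t) = Real.exp (a * t) * Real.sqrt (a * -t) := by
        rw [← hs]; ring
    _ ≤ Real.exp (a * t) * Real.exp (a * -t) :=
        mul_le_mul_of_nonneg_left (h1.trans h2) hE.le
    _ = 1 := h3

/-- RESONANCE: at `lam^{4/5} = 2` the profile solves the feed-forward circuit with `c = 2 lam^{3/5}`. -/
theorem expX_solves {lam : ℝ} (hlam : 0 < lam) (hq : lam ^ (4 / 5 : ℝ) = 2) :
    SolvesODE lam (feedCoeff (2 * lam ^ (3 / 5 : ℝ))) (expX lam) := by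
  intro i n t _
  have hi : i = 0 := Subsingleton.elim _ _
  subst hi
  rw [feed_rhs]
  refine (expX_hasDerivAt lam 0 n t).congr_deriv ?_
  simp only [expX]
  -- exponents: 2·lam^{4(n-1)/5} = lam^{4n/5}
  have hclock : lam ^ ((4 / 5 : ℝ) * ((n - 1 : ℤ) : ℝ)) = lam ^ ((4 / 5 : ℝ) * (n : ℝ)) / 2 := by
    rw [eq_div_iff two_ne_zero, ← hq, ← Real.rpow_add hlam]
    push_cast; congr 1; ring
  have hsqexp : Real.exp (lam ^ ((4 / 5 : ℝ) * ((n - 1 : ℤ) : ℝ)) * t) ^ 2 =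
      Real.exp (lam ^ ((4 / 5 : ℝ) * (n : ℝ)) * t) := by
    rw [hclock, sq, ← Real.exp_add]; congr 1; ring
  -- amplitudes: lam^{3/5} · lam^{n-1} · lam^{-2(n-1)/5} = lam^{4n/5} lam^{-n/5}
  have hamp : lam ^ (3 / 5 : ℝ) * lam ^ ((n : ℝ) - 1) * (lam ^ (-((1 / 5 : ℝ) * ((n - 1 : ℤ) : ℝ)))) ^ 2 =
      lam ^ ((4 / 5 : ℝ) * (n : ℝ)) * lam ^ (-((1 / 5 : ℝ) * (n : ℝ))) := by
    rw [sq]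
    simp only [← Real.rpow_add hlam]
    push_cast; congr 1; ring
  rw [mul_pow, hsqexp]
  linear_combination (-2 * Real.exp (lam ^ ((4 / 5 : ℝ) * (n : ℝ)) * t)) * hamp

/-- `2^{5/4} > 1` and `(2^{5/4})^{4/5} = 2`. -/
theorem coarseLam_facts : 1 < (2 : ℝ) ^ (5 / 4 : ℝ) ∧ ((2 : ℝ) ^ (5 / 4 : ℝ)) ^ (4 / 5 : ℝ) = 2 := by
  constructor
  · exact Real.one_lt_rpow (by norm_num) (by norm_num)
  · rw [← Real.rpow_mul (by norm_num)]; norm_num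

/-- An explicit NON-CONSERVATIVE PUMP at `lam = 2^{5/4}`: symmetric, not cyclic-cancelling, exactly 1-DSS, Type I,
nontrivial, ancient. -/
theorem nonConservativePump :
    ∃ (coeff : Fin 1 → Fin 1 → Fin 1 → Option (Fin 3) → ℝ) (X : Fin 1 → ℤ → ℝ → ℝ),
      IsSym coeff ∧ ¬ IsCyc coeff ∧ SolvesODE ((2 : ℝ) ^ (5 / 4 : ℝ)) coeff X ∧
        IsDSS ((2 : ℝ) ^ (5 / 4 : ℝ)) 1 X ∧ IsTypeI ((2 : ℝ) ^ (5 / 4 : ℝ)) X ∧ IsNontrivial X := by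
  obtain ⟨h1, hq⟩ := coarseLam_facts
  set lam : ℝ := (2 : ℝ) ^ (5 / 4 : ℝ) with hlam
  have hpos : 0 < lam := by linarith
  refine ⟨feedCoeff (2 * lam ^ (3 / 5 : ℝ)), expX lam, isSym_feedCoeff _, ?_, expX_solves hpos hq, ?_, ?_, ?_⟩
  · exact not_isCyc_feedCoeff (mul_ne_zero two_ne_zero (Real.rpow_pos_of_pos hpos _).ne')
  · intro i n t _; exact expX_dss hpos i n t
  · exact ⟨1, fun i n t ht => expX_typeI hpos i n t ht⟩
  · refine ⟨0, 0, -1, by norm_num, ?_⟩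
    simp only [expX]
    exact mul_ne_zero (Real.rpow_pos_of_pos hpos _).ne' (Real.exp_pos _).ne'

/-- **ENERGY CONSERVATION IS LOAD-BEARING (at `lam = 2^{5/4}`)**: the crux with `IsCyc` deleted holds as soon as
the fineness threshold is raised to `2^{5/4}`. Any disproof of `CircuitPump` must therefore use the cyclic
cancellation or the fineness `lam < 2^{5/4}`. -/
theorem withoutCycAbove_holds : WithoutCycAbove ((2 : ℝ) ^ (5 / 4 : ℝ)) := by
  intro lam₀ hlam₀
  obtain ⟨h1, _⟩ := coarseLam_facts
  obtain ⟨coeff, X, hS, _, hode, hdss, hTI, hnt⟩ := nonConservativePump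
  exact ⟨(2 : ℝ) ^ (5 / 4 : ℝ), h1, hlam₀, 1, coeff, 1, X, hS, le_rfl, hode, hdss, hTI, hnt⟩


/-! ## (b5) NEW: the small-constant Liouville theorem — nontriviality is quantitative

(Sorry-free; the same content is proposed for the tree as `Theorems/CircuitPump/Negative/SmallConstant.lean`, there
with `coeffTot` of `Negative/CriticalBound.lean`; here a local copy `totalCoeff` is used because the farm build of
`CriticalBound` was stale when this version was published.) For every solution on `(-∞,0)` with Type-I constant
`C`: the constant self-improves quadratically (`typeI_improve`: `C ↦ S_tot lam^{1/5} C²`), so `S_tot lam^{1/5} C < 1`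
forces `X ≡ 0` (`typeI_small_trivial`), and every nontrivial ancient Type-I solution — every pump — has
`S_tot · lam^{1/5} · C ≥ 1` (`typeI_const_lower_bound`). No DSS, no energy conservation used. -/

/-- Total absolute structure constant (local copy of `CriticalBound.coeffTot`). -/
def totalCoeff {m : ℕ} (coeff : Fin m → Fin m → Fin m → Option (Fin 3) → ℝ) : ℝ := ∑ i : Fin m, coeffSum coeff i

/-- `coeffSum i ≤ totalCoeff`. -/
theorem coeffSum_le_totalCoeff {m : ℕ} (coeff : Fin m → Fin m → Fin m → Option (Fin 3) → ℝ) (i : Fin m) :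
    coeffSum coeff i ≤ totalCoeff coeff := by
  unfold totalCoeff
  exact Finset.single_le_sum (fun j _ => coeffSum_nonneg coeff j) (Finset.mem_univ i)

/-- `totalCoeff` is nonnegative. -/
theorem totalCoeff_nonneg {m : ℕ} (coeff : Fin m → Fin m → Fin m → Option (Fin 3) → ℝ) : 0 ≤ totalCoeff coeff := by
  unfold totalCoeff; exact Finset.sum_nonneg fun j _ => coeffSum_nonneg coeff j


variable {m : ℕ}

/-! ## The quadratic forcing under Type I -/

/-- The nonlinear part of the right-hand side under Type I:
`|F_{i,n}(t) + lam^{4n/5} X_{i,n}(t)| ≤ S_i C² lam^{1/5} lam^{-n/5}/(-t)`. -/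
theorem abs_nonlin_le {lam : ℝ} (hlam : 1 < lam) (coeff : Fin m → Fin m → Fin m → Option (Fin 3) → ℝ)
    {X : Fin m → ℤ → ℝ → ℝ} {C : ℝ}
    (hTI : ∀ (i : Fin m) (n : ℤ) (t : ℝ), t < 0 → lam ^ ((3 / 5 : ℝ) * n) * |X i n t| ≤ C / Real.sqrt (-t))
    (i : Fin m) (n : ℤ) (t : ℝ) (ht : t < 0) :
    |rhsF lam coeff X i n t + lam ^ ((4 / 5 : ℝ) * n) * X i n t| ≤
      coeffSum coeff i * C ^ 2 * lam ^ (1 / 5 : ℝ) * lam ^ (-((1 / 5 : ℝ) * n)) / (-t) := by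
  unfold rhsF
  rw [show ∀ (A S : ℝ), -A * X i n t + S + A * X i n t = S from fun A S => by ring]
  refine (Finset.abs_sum_le_sum_abs _ _).trans ?_
  unfold coeffSum
  rw [Finset.sum_mul, Finset.sum_mul, Finset.sum_mul, Finset.sum_div]
  refine Finset.sum_le_sum fun i₁ _ => ?_
  refine (Finset.abs_sum_le_sum_abs _ _).trans ?_
  rw [Finset.sum_mul, Finset.sum_mul, Finset.sum_mul, Finset.sum_div]
  refine Finset.sum_le_sum fun i₂ _ => ?_
  refine (Finset.abs_sum_le_sum_abs _ _).trans ?_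
  rw [Finset.sum_mul, Finset.sum_mul, Finset.sum_mul, Finset.sum_div]
  refine Finset.sum_le_sum fun μ _ => ?_
  exact monomial_abs_le hlam hTI (coeff i₁ i₂ i μ) _ _ _ (offset_exponent_le μ) i₁ i₂ n t ht

/-! ## The barrier `Ψ(τ) = e^{aτ} log(1 + 1/(a(-τ)))` -/

/-- The barrier and its derivative. -/
theorem barrier_hasDerivAt {a τ : ℝ} (ha : 0 < a) (hτ : τ < 0) :
    HasDerivAt (fun x : ℝ => Real.exp (a * x) * Real.log (1 + (a * -x)⁻¹))
      (a * Real.exp (a * τ) * Real.log (1 + (a * -τ)⁻¹) +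
        Real.exp (a * τ) * (a / (a * -τ) ^ 2 / (1 + (a * -τ)⁻¹))) τ := by
  have hu : 0 < a * -τ := mul_pos ha (by linarith)
  have h1 : HasDerivAt (fun x : ℝ => Real.exp (a * x)) (Real.exp (a * τ) * (a * 1)) τ :=
    ((hasDerivAt_id τ).const_mul a).exp
  have h2 : HasDerivAt (fun x : ℝ => a * -x) (a * -1) τ := (hasDerivAt_neg τ).const_mul a
  have h3 : HasDerivAt (fun x : ℝ => (a * -x)⁻¹) (-(a * -1) / (a * -τ) ^ 2) τ := h2.inv hu.ne'
  have h4 : HasDerivAt (fun x : ℝ => 1 + (a * -x)⁻¹) (0 + -(a * -1) / (a * -τ) ^ 2) τ :=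
    (hasDerivAt_const τ 1).add h3
  have hpos : 0 < 1 + (a * -τ)⁻¹ := by positivity
  have h5 : HasDerivAt (fun x : ℝ => Real.log (1 + (a * -x)⁻¹))
      ((0 + -(a * -1) / (a * -τ) ^ 2) / (1 + (a * -τ)⁻¹)) τ := h4.log hpos.ne'
  refine (h1.mul h5).congr_deriv ?_
  ring

/-- The barrier dominates the exponential-integral kernel: `e^{aτ}/(-τ) ≤ Ψ'(τ)`; this is
`log(1 + 1/u) ≥ 1/(1+u)`, `u = a(-τ)`. -/
theorem kernel_le_barrier_deriv {a τ : ℝ} (ha : 0 < a) (hτ : τ < 0) :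
    Real.exp (a * τ) / -τ ≤
      a * Real.exp (a * τ) * Real.log (1 + (a * -τ)⁻¹) +
        Real.exp (a * τ) * (a / (a * -τ) ^ 2 / (1 + (a * -τ)⁻¹)) := by
  have hnτ : 0 < -τ := by linarith
  set u : ℝ := a * -τ with hu
  have hupos : 0 < u := mul_pos ha hnτ
  have hE : 0 < Real.exp (a * τ) := Real.exp_pos _
  -- log(1 + 1/u) ≥ 1 - (1 + 1/u)⁻¹ = 1/(1+u)
  have hx : 0 < 1 + u⁻¹ := by positivity
  have hlog : 1 - (1 + u⁻¹)⁻¹ ≤ Real.log (1 + u⁻¹) := Real.one_sub_inv_le_log_of_pos hx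
  have hinv : (1 + u⁻¹)⁻¹ = u / (u + 1) := by
    field_simp
  have hkey : 1 / (u + 1) ≤ Real.log (1 + u⁻¹) := by
    have : 1 - u / (u + 1) = 1 / (u + 1) := by field_simp; ring
    rw [hinv, this] at hlog
    exact hlog
  -- the second summand equals e^{aτ} · a/(u(u+1))
  have h2 : a / u ^ 2 / (1 + u⁻¹) = a / (u * (u + 1)) := by
    field_simp
  rw [h2]
  -- target: e/(-τ) ≤ a e log + e a/(u(u+1)); note a/u = 1/(-τ)
  have hτu : (1 : ℝ) / -τ = a / u := by
    rw [hu]; field_simp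
  have hsplit : a / u = a / (u + 1) + a / (u * (u + 1)) := by
    field_simp
  calc Real.exp (a * τ) / -τ = Real.exp (a * τ) * (a / u) := by rw [← hτu]; ring
    _ = Real.exp (a * τ) * (a * (1 / (u + 1))) + Real.exp (a * τ) * (a / (u * (u + 1))) := by
        rw [hsplit]; ring
    _ ≤ Real.exp (a * τ) * (a * Real.log (1 + u⁻¹)) + Real.exp (a * τ) * (a / (u * (u + 1))) := by
        have := mul_le_mul_of_nonneg_left hkey ha.le
        have := mul_le_mul_of_nonneg_left this hE.le
        linarith
    _ = a * Real.exp (a * τ) * Real.log (1 + u⁻¹) + Real.exp (a * τ) * (a / (u * (u + 1))) := by ring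

/-- The barrier is nonnegative. -/
theorem barrier_nonneg {a τ : ℝ} (ha : 0 < a) (hτ : τ < 0) :
    0 ≤ Real.exp (a * τ) * Real.log (1 + (a * -τ)⁻¹) := by
  have hu : 0 < a * -τ := mul_pos ha (by linarith)
  exact mul_nonneg (Real.exp_pos _).le (Real.log_nonneg (le_add_of_nonneg_right (inv_nonneg.2 hu.le)))

/-- `log(1 + x) ≤ √x` for `x ≥ 0` (from `e^y ≥ 1 + y + y²/2 + y³/6 ≥ 1 + y²`, `y = √x`). -/
theorem log_one_add_le_sqrt {x : ℝ} (hx : 0 ≤ x) : Real.log (1 + x) ≤ Real.sqrt x := by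
  set y := Real.sqrt x with hy
  have hy0 : 0 ≤ y := Real.sqrt_nonneg x
  have hyy : y ^ 2 = x := Real.sq_sqrt hx
  have hsum : ∑ i ∈ Finset.range 4, y ^ i / (Nat.factorial i) ≤ Real.exp y := Real.sum_le_exp_of_nonneg hy0 4
  have hexp : 1 + y ^ 2 ≤ Real.exp y := by
    have h4 : ∑ i ∈ Finset.range 4, y ^ i / (Nat.factorial i) = 1 + y + y ^ 2 / 2 + y ^ 3 / 6 := by
      simp [Finset.sum_range_succ, Nat.factorial]
    rw [h4] at hsum
    nlinarith [sq_nonneg (y - 3 / 2), hy0]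
  have hpos : 0 < 1 + x := by linarith
  calc Real.log (1 + x) = Real.log (1 + y ^ 2) := by rw [hyy]
    _ ≤ Real.log (Real.exp y) := Real.log_le_log (by positivity) hexp
    _ = y := Real.log_exp y

/-- `√s · log(1 + 1/s) ≤ 1` for `s > 0`. -/
theorem sqrt_mul_log_le_one {s : ℝ} (hs : 0 < s) : Real.sqrt s * Real.log (1 + s⁻¹) ≤ 1 := by
  have h := log_one_add_le_sqrt (inv_nonneg.2 hs.le)
  have hs0 : 0 ≤ Real.sqrt s := Real.sqrt_nonneg s
  calc Real.sqrt s * Real.log (1 + s⁻¹) ≤ Real.sqrt s * Real.sqrt s⁻¹ := mul_le_mul_of_nonneg_left h hs0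
    _ = 1 := by
      rw [Real.sqrt_inv, mul_inv_cancel₀ (Real.sqrt_pos.2 hs).ne']

/-! ## The quadratic self-improvement of the Type-I constant -/

/-- CONJUGATED FENCE: for `T ≤ t₀ < 0`,
`|e^{a t₀} X_{i,n}(t₀)| ≤ |e^{aT} X_{i,n}(T)| + K_n Ψ(t₀)`, `a = lam^{4n/5}`, `K_n = S_i C² lam^{1/5} lam^{-n/5}`. -/
theorem conj_fence {lam : ℝ} (hlam : 1 < lam) (coeff : Fin m → Fin m → Fin m → Option (Fin 3) → ℝ)
    {X : Fin m → ℤ → ℝ → ℝ} (hode : SolvesODE lam coeff X) {C : ℝ}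
    (hTI : ∀ (i : Fin m) (n : ℤ) (t : ℝ), t < 0 → lam ^ ((3 / 5 : ℝ) * n) * |X i n t| ≤ C / Real.sqrt (-t))
    (i : Fin m) (n : ℤ) {T t₀ : ℝ} (hT : T ≤ t₀) (ht₀ : t₀ < 0) :
    |Real.exp (lam ^ ((4 / 5 : ℝ) * n) * t₀) * X i n t₀| ≤
      |Real.exp (lam ^ ((4 / 5 : ℝ) * n) * T) * X i n T| +
        coeffSum coeff i * C ^ 2 * lam ^ (1 / 5 : ℝ) * lam ^ (-((1 / 5 : ℝ) * n)) *
          (Real.exp (lam ^ ((4 / 5 : ℝ) * n) * t₀) * Real.log (1 + (lam ^ ((4 / 5 : ℝ) * n) * -t₀)⁻¹)) := by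
  have hpos : 0 < lam := by linarith
  set a : ℝ := lam ^ ((4 / 5 : ℝ) * n) with ha
  have hapos : 0 < a := Real.rpow_pos_of_pos hpos _
  set K : ℝ := coeffSum coeff i * C ^ 2 * lam ^ (1 / 5 : ℝ) * lam ^ (-((1 / 5 : ℝ) * n)) with hK
  have hKnn : 0 ≤ K := by
    rw [hK]; have := coeffSum_nonneg coeff i; positivity
  -- the conjugated mode and its derivative
  set f : ℝ → ℝ := fun x => Real.exp (a * x) * X i n x with hf
  set f' : ℝ → ℝ := fun x => Real.exp (a * x) * (rhsF lam coeff X i n x + a * X i n x) with hf'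
  have hderf : ∀ x : ℝ, x < 0 → HasDerivAt f (f' x) x := by
    intro x hx
    have h1 : HasDerivAt (fun y : ℝ => Real.exp (a * y)) (Real.exp (a * x) * (a * 1)) x :=
      ((hasDerivAt_id x).const_mul a).exp
    have h2 := hode i n x hx
    refine (h1.mul h2).congr_deriv ?_
    simp only [hf', ha]
    ring
  -- the barrier
  set Ψ : ℝ → ℝ := fun x => Real.exp (a * x) * Real.log (1 + (a * -x)⁻¹) with hΨ
  set Ψ' : ℝ → ℝ := fun x => a * Real.exp (a * x) * Real.log (1 + (a * -x)⁻¹) +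
      Real.exp (a * x) * (a / (a * -x) ^ 2 / (1 + (a * -x)⁻¹)) with hΨ'
  have hderΨ : ∀ x : ℝ, x < 0 → HasDerivAt Ψ (Ψ' x) x := fun x hx => barrier_hasDerivAt hapos hx
  set B : ℝ → ℝ := fun x => |f T| + K * (Ψ x - Ψ T) with hB
  set B' : ℝ → ℝ := fun x => K * Ψ' x with hB'
  have hderB : ∀ x : ℝ, x < 0 → HasDerivAt B (B' x) x := by
    intro x hx
    have := ((hderΨ x hx).sub (hasDerivAt_const x (Ψ T))).const_mul K
    have h2 : HasDerivAt B (0 + K * (Ψ' x - 0)) x := (hasDerivAt_const x _).add this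
    refine h2.congr_deriv ?_
    simp only [hB']; ring
  have hfc : ContinuousOn f (Icc T t₀) :=
    fun x hx => (hderf x (lt_of_le_of_lt hx.2 ht₀)).continuousAt.continuousWithinAt
  have hfw : ∀ x ∈ Ico T t₀, HasDerivWithinAt f (f' x) (Ici x) x :=
    fun x hx => (hderf x (lt_trans hx.2 ht₀)).hasDerivWithinAt
  have hBc : ContinuousOn B (Icc T t₀) :=
    fun x hx => (hderB x (lt_of_le_of_lt hx.2 ht₀)).continuousAt.continuousWithinAt
  have hBw : ∀ x ∈ Ico T t₀, HasDerivWithinAt B (B' x) (Ici x) x :=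
    fun x hx => (hderB x (lt_trans hx.2 ht₀)).hasDerivWithinAt
  have hfa : ‖f T‖ ≤ B T := by simp [hB]
  have hbound : ∀ x ∈ Ico T t₀, ‖f' x‖ ≤ B' x := by
    intro x hx
    have hx0 : x < 0 := lt_trans hx.2 ht₀
    have hnx : 0 < -x := by linarith
    have hN := abs_nonlin_le hlam coeff hTI i n x hx0
    rw [Real.norm_eq_abs]
    simp only [hf', hB']
    rw [abs_mul, abs_of_pos (Real.exp_pos _)]
    have hk := kernel_le_barrier_deriv hapos hx0
    calc Real.exp (a * x) * |rhsF lam coeff X i n x + a * X i n x|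
        ≤ Real.exp (a * x) * (K / -x) := by
          refine mul_le_mul_of_nonneg_left ?_ (Real.exp_pos _).le
          rw [hK, ha]; exact hN
      _ = K * (Real.exp (a * x) / -x) := by ring
      _ ≤ K * Ψ' x := mul_le_mul_of_nonneg_left hk hKnn
  have key := image_norm_le_of_norm_deriv_right_le_deriv_boundary' hfc hfw hfa hBc hBw hbound
    (right_mem_Icc.2 hT)
  rw [Real.norm_eq_abs] at key
  simp only [hB] at key
  have hΨT : 0 ≤ Ψ T := barrier_nonneg hapos (lt_of_le_of_lt hT ht₀)
  have : K * (Ψ t₀ - Ψ T) ≤ K * Ψ t₀ := by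
    apply mul_le_mul_of_nonneg_left _ hKnn; linarith
  have hgoal : |f t₀| ≤ |f T| + K * Ψ t₀ := key.trans (by linarith)
  simpa only [hf, hΨ] using hgoal

/-- THE QUADRATIC SELF-IMPROVEMENT: a solution on `(-∞,0)` with Type-I constant `C` has Type-I constant
`S_tot · lam^{1/5} · C²`. -/
theorem typeI_improve {lam : ℝ} (hlam : 1 < lam) (coeff : Fin m → Fin m → Fin m → Option (Fin 3) → ℝ)
    {X : Fin m → ℤ → ℝ → ℝ} (hode : SolvesODE lam coeff X) {C : ℝ}
    (hTI : ∀ (i : Fin m) (n : ℤ) (t : ℝ), t < 0 → lam ^ ((3 / 5 : ℝ) * n) * |X i n t| ≤ C / Real.sqrt (-t))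
    (i : Fin m) (n : ℤ) (t : ℝ) (ht : t < 0) :
    lam ^ ((3 / 5 : ℝ) * n) * |X i n t| ≤ totalCoeff coeff * lam ^ (1 / 5 : ℝ) * C ^ 2 / Real.sqrt (-t) := by
  have hpos : 0 < lam := by linarith
  have hnt : 0 < -t := by linarith
  set a : ℝ := lam ^ ((4 / 5 : ℝ) * n) with ha
  have hapos : 0 < a := Real.rpow_pos_of_pos hpos _
  set w : ℝ := lam ^ (-((1 / 5 : ℝ) * n)) with hw
  have hwpos : 0 < w := Real.rpow_pos_of_pos hpos _
  set w3 : ℝ := lam ^ ((3 / 5 : ℝ) * n) with hw3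
  have hw3pos : 0 < w3 := Real.rpow_pos_of_pos hpos _
  set K : ℝ := coeffSum coeff i * C ^ 2 * lam ^ (1 / 5 : ℝ) * w with hK
  have hKnn : 0 ≤ K := by rw [hK]; have := coeffSum_nonneg coeff i; positivity
  have hC : 0 ≤ C := typeI_const_nonneg hlam hTI i
  -- Step 1: |e^{at} X(t)| ≤ K Ψ(t), by the fence and T → -∞
  have hY : |Real.exp (a * t) * X i n t| ≤ K * (Real.exp (a * t) * Real.log (1 + (a * -t)⁻¹)) := by
    apply le_of_forall_pos_lt_add
    intro ε hε
    -- choose T ≤ min t (-1) with C lam^{-3n/5}/(a(-T)) < ε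
    obtain ⟨R, hR1, hRt, hRε⟩ : ∃ R : ℝ, 1 ≤ R ∧ -t ≤ R ∧ C * w3⁻¹ / (a * ε) < R :=
      ⟨max (max 1 (-t)) (C * w3⁻¹ / (a * ε) + 1), le_trans (le_max_left _ _) (le_max_left _ _),
        le_trans (le_max_right _ _) (le_max_left _ _), lt_of_lt_of_le (lt_add_one _) (le_max_right _ _)⟩
    have hRpos : 0 < R := by linarith
    have hT : -R ≤ t := by linarith
    have hfence := conj_fence hlam coeff hode hTI i n hT ht
    -- bound the boundary term
    have hXT := abs_le_of_typeI hlam hTI i n (-R) (by linarith)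
    rw [neg_neg] at hXT
    have hsq : 1 ≤ Real.sqrt R := by
      rw [show (1 : ℝ) = Real.sqrt 1 from Real.sqrt_one.symm]; exact Real.sqrt_le_sqrt hR1
    have hexp : Real.exp (a * -R) * (a * R) ≤ 1 := by
      have h1 : a * R + 1 ≤ Real.exp (a * R) := Real.add_one_le_exp _
      have h2 : Real.exp (a * -R) * Real.exp (a * R) = 1 := by
        rw [← Real.exp_add]; simp
      have h3 : 0 < Real.exp (a * -R) := Real.exp_pos _
      nlinarith
    have hbd : |Real.exp (a * -R) * X i n (-R)| < ε := by
      rw [abs_mul, abs_of_pos (Real.exp_pos _)]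
      have h1 : |X i n (-R)| ≤ C * w3⁻¹ := by
        have : C * lam ^ (-((3 / 5 : ℝ) * n)) / Real.sqrt R ≤ C * w3⁻¹ := by
          rw [Real.rpow_neg hpos.le, ← hw3]
          rw [div_le_iff₀ (by linarith)]
          have : 0 ≤ C * w3⁻¹ := by positivity
          nlinarith
        exact hXT.trans this
      have haR : 0 < a * R := mul_pos hapos hRpos
      have h2 : Real.exp (a * -R) ≤ 1 / (a * R) := by
        rw [le_div_iff₀ haR]; exact hexp
      have h3 : C * w3⁻¹ / (a * R) < ε := by
        rw [div_lt_iff₀ haR]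
        have := (div_lt_iff₀ (mul_pos hapos hε)).1 hRε
        nlinarith
      calc Real.exp (a * -R) * |X i n (-R)| ≤ 1 / (a * R) * (C * w3⁻¹) :=
            mul_le_mul h2 h1 (abs_nonneg _) (by positivity)
        _ = C * w3⁻¹ / (a * R) := by ring
        _ < ε := h3
    have := hfence
    simp only [← ha] at this
    linarith
  -- Step 2: unwind the conjugation and evaluate the barrier
  have hE : 0 < Real.exp (a * t) := Real.exp_pos _
  have hX : |X i n t| ≤ K * Real.log (1 + (a * -t)⁻¹) := by
    rw [abs_mul, abs_of_pos hE] at hY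
    have : Real.exp (a * t) * |X i n t| ≤ Real.exp (a * t) * (K * Real.log (1 + (a * -t)⁻¹)) := by
      calc _ ≤ K * (Real.exp (a * t) * Real.log (1 + (a * -t)⁻¹)) := hY
        _ = _ := by ring
    exact le_of_mul_le_mul_left this hE
  -- Step 3: w3 · K · log(1 + 1/s) · √(-t) ≤ S_i C² lam^{1/5} (√s log(1+1/s) ≤ 1)
  have hs : 0 < a * -t := mul_pos hapos hnt
  have hsl := sqrt_mul_log_le_one hs
  have hsqrt_s : Real.sqrt (a * -t) = lam ^ ((2 / 5 : ℝ) * n) * Real.sqrt (-t) := by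
    rw [Real.sqrt_mul hapos.le, ha, Real.sqrt_eq_rpow, ← Real.rpow_mul hpos.le]
    congr 1; congr 1; ring
  have hw3w : w3 * w = lam ^ ((2 / 5 : ℝ) * n) := by
    rw [hw3, hw, ← Real.rpow_add hpos]; congr 1; ring
  have hsqpos : 0 < Real.sqrt (-t) := Real.sqrt_pos.2 hnt
  rw [le_div_iff₀ hsqpos]
  have hSi := coeffSum_le_totalCoeff coeff i
  have hSinn := coeffSum_nonneg coeff i
  calc w3 * |X i n t| * Real.sqrt (-t) ≤ w3 * (K * Real.log (1 + (a * -t)⁻¹)) * Real.sqrt (-t) := by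
        apply mul_le_mul_of_nonneg_right _ hsqpos.le
        exact mul_le_mul_of_nonneg_left hX hw3pos.le
    _ = coeffSum coeff i * C ^ 2 * lam ^ (1 / 5 : ℝ) *
          ((w3 * w) * Real.sqrt (-t) * Real.log (1 + (a * -t)⁻¹)) := by rw [hK]; ring
    _ = coeffSum coeff i * C ^ 2 * lam ^ (1 / 5 : ℝ) *
          (Real.sqrt (a * -t) * Real.log (1 + (a * -t)⁻¹)) := by rw [hw3w, hsqrt_s]
    _ ≤ coeffSum coeff i * C ^ 2 * lam ^ (1 / 5 : ℝ) * 1 := by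
        apply mul_le_mul_of_nonneg_left hsl; positivity
    _ ≤ totalCoeff coeff * lam ^ (1 / 5 : ℝ) * C ^ 2 := by
        rw [mul_one]
        have : 0 ≤ C ^ 2 * lam ^ (1 / 5 : ℝ) := by positivity
        nlinarith

/-- THE SMALL-CONSTANT LIOUVILLE THEOREM: if `S_tot · lam^{1/5} · C < 1` then the solution vanishes
identically on `(-∞,0)`. -/
theorem typeI_small_trivial {lam : ℝ} (hlam : 1 < lam) (coeff : Fin m → Fin m → Fin m → Option (Fin 3) → ℝ)
    {X : Fin m → ℤ → ℝ → ℝ} (hode : SolvesODE lam coeff X) {C : ℝ}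
    (hTI : ∀ (i : Fin m) (n : ℤ) (t : ℝ), t < 0 → lam ^ ((3 / 5 : ℝ) * n) * |X i n t| ≤ C / Real.sqrt (-t))
    (hsmall : totalCoeff coeff * lam ^ (1 / 5 : ℝ) * C < 1) :
    ∀ (i : Fin m) (n : ℤ) (t : ℝ), t < 0 → X i n t = 0 := by
  have hpos : 0 < lam := by linarith
  set κ : ℝ := totalCoeff coeff * lam ^ (1 / 5 : ℝ) with hκ
  have hκnn : 0 ≤ κ := by rw [hκ]; have := totalCoeff_nonneg coeff; positivity
  -- the improving sequence of constants
  set Cs : ℕ → ℝ := fun j => Nat.rec C (fun _ c => κ * c ^ 2) j with hCs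
  have hCs0 : Cs 0 = C := rfl
  have hCsS : ∀ j, Cs (j + 1) = κ * Cs j ^ 2 := fun j => rfl
  have hall : ∀ j, ∀ (i : Fin m) (n : ℤ) (t : ℝ), t < 0 →
      lam ^ ((3 / 5 : ℝ) * n) * |X i n t| ≤ Cs j / Real.sqrt (-t) := by
    intro j
    induction j with
    | zero => simpa [hCs0] using hTI
    | succ j ih =>
      intro i n t ht
      rw [hCsS]
      have := typeI_improve hlam coeff hode ih i n t ht
      simpa [hκ, mul_comm, mul_left_comm, mul_assoc] using this
  intro i n t ht
  by_contra hx
  have hnt : 0 < -t := by linarith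
  have hC : 0 ≤ C := typeI_const_nonneg hlam hTI i
  have hsq : 0 < Real.sqrt (-t) := Real.sqrt_pos.2 hnt
  set δ : ℝ := lam ^ ((3 / 5 : ℝ) * n) * |X i n t| * Real.sqrt (-t) with hδ
  have hδpos : 0 < δ := by
    rw [hδ]; have := Real.rpow_pos_of_pos hpos ((3 / 5 : ℝ) * n); have := abs_pos.2 hx; positivity
  have hδle : ∀ j, δ ≤ Cs j := fun j => by
    have := (le_div_iff₀ hsq).1 (hall j i n t ht); rwa [hδ]
  -- κ Cs j ≤ (κ C)^(j+1)
  have hθ1 : κ * C < 1 := by simpa [hκ] using hsmall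
  have hθ0 : 0 ≤ κ * C := mul_nonneg hκnn hC
  have hgeom : ∀ j, κ * Cs j ≤ (κ * C) ^ (j + 1) := by
    intro j
    induction j with
    | zero => simp [hCs0]
    | succ j ih =>
      rw [hCsS]
      have hnn : 0 ≤ κ * Cs j := by
        have := hδle j; have : 0 ≤ Cs j := by linarith
        exact mul_nonneg hκnn this
      calc κ * (κ * Cs j ^ 2) = (κ * Cs j) ^ 2 := by ring
        _ ≤ ((κ * C) ^ (j + 1)) ^ 2 := pow_le_pow_left₀ hnn ih 2
        _ = (κ * C) ^ (2 * j + 2) := by rw [← pow_mul]; ring_nf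
        _ ≤ (κ * C) ^ (j + 1 + 1) := pow_le_pow_of_le_one hθ0 hθ1.le (by omega)
  rcases eq_or_lt_of_le hκnn with hκ0 | hκpos
  · -- κ = 0: the first improved constant is already 0
    have h1 : δ ≤ Cs (0 + 1) := hδle (0 + 1)
    rw [hCsS, ← hκ0] at h1
    simp at h1
    linarith
  · obtain ⟨j, hj⟩ := exists_pow_lt_of_lt_one (mul_pos hκpos hδpos) hθ1
    have h1 : κ * Cs j < κ * δ :=
      lt_of_le_of_lt ((hgeom j).trans (pow_le_pow_of_le_one hθ0 hθ1.le (Nat.le_succ j))) hj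
    have h2 : Cs j < δ := lt_of_mul_lt_mul_left h1 hκnn
    linarith [hδle j]

/-- COROLLARY (quantitative nontriviality): a nontrivial ancient Type-I solution — in particular every witness
of `CircuitPump` — has `S_tot · lam^{1/5} · C ≥ 1`, i.e. its Type-I constant is at least `lam^{-1/5}/Σ|coeff|`. -/
theorem typeI_const_lower_bound {lam : ℝ} (hlam : 1 < lam)
    (coeff : Fin m → Fin m → Fin m → Option (Fin 3) → ℝ) {X : Fin m → ℤ → ℝ → ℝ}
    (hode : SolvesODE lam coeff X) {C : ℝ}
    (hTI : ∀ (i : Fin m) (n : ℤ) (t : ℝ), t < 0 → lam ^ ((3 / 5 : ℝ) * n) * |X i n t| ≤ C / Real.sqrt (-t))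
    (hnt : IsNontrivial X) : 1 ≤ totalCoeff coeff * lam ^ (1 / 5 : ℝ) * C := by
  by_contra h
  push Not at h
  obtain ⟨i, n, t, ht, hx⟩ := hnt
  exact hx (typeI_small_trivial hlam coeff hode hTI h i n t ht)

/-- The same for the crux's witness clauses `IsPump`. -/
theorem isPump_typeI_const_lower_bound {lam : ℝ} (hlam : 1 < lam) {m : ℕ}
    {coeff : Fin m → Fin m → Fin m → Option (Fin 3) → ℝ} {k : ℕ} {X : Fin m → ℤ → ℝ → ℝ}
    (hP : IsPump lam m coeff k X) {C : ℝ}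
    (hC : ∀ (i : Fin m) (n : ℤ) (t : ℝ), t < 0 → lam ^ ((3 / 5 : ℝ) * n) * |X i n t| ≤ C / Real.sqrt (-t)) :
    1 ≤ totalCoeff coeff * lam ^ (1 / 5 : ℝ) * C :=
  typeI_const_lower_bound hlam coeff hP.2.2.2.1 hC hP.2.2.2.2.2.2


/-! ## (e) Near-misses and the open sub-questions -/

/-- **(e1) TYPE I SELF-IMPROVES TO CRITICAL BOUNDEDNESS** — PROVED AND LANDED:
`Theorems/CircuitPump/Negative/CriticalBound.lean`, theorem `CircuitPumpNegative.typeI_critical_bound` (same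
statement). It is restated with `sorry` here ONLY because the farm build of that module was stale when this version
of the work file was published (the import is deferred to the next version); cite the tree theorem, not this stub.
Content: for every solution of the circuit ODE on `(-∞,0)` with the Type-I bound,
`sup_{i,n,t<0} lam^{n/5}|X_{i,n}(t)| < ∞` (two-step bootstrap: `round_one` then an integrable second round); hence
finite residues `X_{i,n}(0⁻)`, DSS-periodic frozen `1/|x|` trail, bounded Lipschitz k = 1 profiles. -/
theorem typeI_critical_bound {m : ℕ} {lam : ℝ} (hlam : 1 < lam)
    (coeff : Fin m → Fin m → Fin m → Option (Fin 3) → ℝ) (X : Fin m → ℤ → ℝ → ℝ)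
    (hode : SolvesODE lam coeff X) (hTI : IsTypeI lam X) :
    ∃ C' : ℝ, ∀ (i : Fin m) (n : ℤ) (t : ℝ), t < 0 → lam ^ ((1 / 5 : ℝ) * n) * |X i n t| ≤ C' := by
  sorry

/-- **(e2) SCALAR PUMPS ARE SIGN-DEFINITE** — PROVED AND LANDED (`Negative/ScalarSign.lean`,
`CircuitPumpNegative.scalar_nonneg`, for every `a ≤ 0`; `a ≥ 0` is the mirror image `X ↦ -X`): for m = 1 every
solution on `(-∞,0)` with the Type-I bound is `≥ 0` componentwise, so the m = 1 question is about NON-NEGATIVE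
infinite-energy ancient solutions of the dyadic model (BMR's setting, but ancient/infinite-energy, which their
finite-energy theorem does not decide). -/
theorem scalar_nonneg {lam : ℝ} (hlam : 1 < lam) {a : ℝ} (ha : a ≤ 0) (X : Fin 1 → ℤ → ℝ → ℝ)
    (hode : SolvesODE lam (scalarCoeff a) X) (hTI : IsTypeI lam X) :
    ∀ (n : ℤ) (t : ℝ), t < 0 → 0 ≤ X 0 n t :=
  fun n t ht => Theorems.CircuitPumpNegative.scalar_nonneg hlam ha X hode hTI n t ht

/-- **(e3) THE OPEN SCALAR SUB-QUESTION: does the m = 1 chain pump at α = 2/5?**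
`ScalarPumpAt lam` := the crux's witness clause with `m = 1` at scale ratio `lam`. In the `k = 1` profile frame
(`X_n(t) = lam^{-n/5}φ(lam^{4n/5}|t|)`): ∃ nontrivial bounded `φ ≥ 0` on `(0,∞)`, `φ(∞) = 0`, with
`φ' = φ + lam^{-1/5}φ(s)φ(lam^{4/5}s) - lam^{-3/5}φ(lam^{-4/5}s)²`; exact identities: `lam^{1/5}∫φ² = ∫φ +
lam^{-1/5}∫φ(s)φ(lam^{4/5}s) + φ(0⁺)`, `(1 - lam^{-2/5})·lam^{1/5}∫φ²(s)φ(lam^{4/5}s) = ∫φ² + ½φ(0⁺)²` (budget),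
hence `sup φ ≥ 1/(lam^{1/5} - lam^{-1/5})` and `φ'(0⁺) > 0`. By (b5) also `C ≥ lam^{-1/5}/(4|a|)` for the Type-I
constant. STATUS (cycle 1 numerics, kit j008109/j008552/j009667 + folder/local, dossier `ScalarNumericsC1.md`): at
q = lam^{4/5} = 2 and 1.5 the declocking continuation from the exogenously clocked profile FOLDS and its upper
branch escapes to infinite amplitude as σ → 0⁺ (an exact autonomous decaying FRONT WITHOUT TRAIL); no autonomous
scalar profile found; positive scalar pumps are rigorously excluded at lam = 2^{5/2} (BMR invariant region) and
OPEN for every other lam. Cycle 2: unchanged (the m ≥ 2 lines made the scalar question non-blocking: the lead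
instantiates `stub_clockBox` with the m = 2 seeded Toda circuit). -/
def ScalarPumpAt (lam : ℝ) : Prop :=
  ∃ (coeff : Fin 1 → Fin 1 → Fin 1 → Option (Fin 3) → ℝ) (k : ℕ) (X : Fin 1 → ℤ → ℝ → ℝ),
    IsPump lam 1 coeff k X

/-- The scalar version of the crux (m pinned to 1); `ScalarCircuitPump → CircuitPump` trivially. -/
def ScalarCircuitPump : Prop := ∀ lam₀ : ℝ, 1 < lam₀ → ∃ lam : ℝ, 1 < lam ∧ lam < lam₀ ∧ ScalarPumpAt lam

/-- `ScalarCircuitPump` implies the crux. -/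
theorem circuitPump_of_scalar (h : ScalarCircuitPump) : Theses.PerpetualPump.CircuitPump := by
  rw [circuitPump_iff]
  intro lam₀ hlam₀
  obtain ⟨lam, hlam, hlt, coeff, k, X, hP⟩ := h lam₀ hlam₀
  exact ⟨lam, hlam, hlt, 1, coeff, k, X, hP⟩

/-- The Type-I constant of a scalar pump is at least `lam^{-1/5}/(4|a|)` (instance of (b5):
`S_tot(scalarCoeff a) = |a| + |a| + 2|a| = 4|a|`). -/
theorem scalar_typeI_const_lower_bound {lam a : ℝ} (hlam : 1 < lam) {k : ℕ} {X : Fin 1 → ℤ → ℝ → ℝ}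
    (hP : IsPump lam 1 (scalarCoeff a) k X) {C : ℝ}
    (hC : ∀ (i : Fin 1) (n : ℤ) (t : ℝ), t < 0 → lam ^ ((3 / 5 : ℝ) * n) * |X i n t| ≤ C / Real.sqrt (-t)) :
    1 ≤ 4 * |a| * lam ^ (1 / 5 : ℝ) * C := by
  have h := isPump_typeI_const_lower_bound hlam hP hC
  have htot : totalCoeff (scalarCoeff a) = 4 * |a| := by
    simp only [totalCoeff, coeffSum, Fin.sum_univ_one, Fintype.sum_option, Fin.sum_univ_three]
    simp [scalarCoeff, abs_mul]
    ring
  rwa [htot] at h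

/-!
## (g) NEW (cycle 2): closed forms, and the conservative exponential design problem

(g1) CLOSED-FORM PUMPS NEED `lam ≥ 2^{5/4}` (paper lemma, all circuits of the class, conservative or not, any `m`,
any period `k`). Suppose every mode is a finite exponential sum `X_{i,n}(t) = Σ_r a_{i,n,r} e^{β_{i,n,r} t}` with
positive rates (the only closed forms compatible with decay at `t = -∞` and analyticity; (a4) is of this type).
Let `r_n := min {β_{i,n,r}}` over the modes supported at scale `n`. In the equation of a mode at scale `n+1`
attaining `r_{n+1}`, the coefficient of `e^{r_{n+1}t}` on the left is `(r_{n+1} + lam^{4(n+1)/5})·a ≠ 0`, so some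
quadratic monomial on the right has rate sum exactly `r_{n+1}`; its two factors sit at scales `(n+1,n+1)`,
`(n+2,n+1)` or `(n,n)` (Tao's shift set), and the first two options have rate sum `> r_{n+1}`. Hence the monomial
is fed from scale `n` and `r_{n+1} ≥ 2 r_n` ("the minimal rate at least DOUBLES per scale step"; in particular all
scales below a supported scale are supported). DSS gives `r_{n+k} = lam^{4k/5} r_n`, so `lam^{4k/5} ≥ 2^k`, i.e.
`lam ≥ 2^{5/4}`: NO circuit of Tao's class has a closed-form (finite exponential sum) DSS pump at any
`lam < 2^{5/4} ≈ 2.378`, and (a4) sits exactly at the threshold. For the crux (fine lam) every witness is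
genuinely transcendental — consistent with the ideators' "no Dirichlet-series profile" self-kill and with the
clock picture (the one-period map is only affinely, not exactly, linear in the amplitude).

(g2) CONSERVATIVE EXPONENTIAL PUMPS AT COARSE `lam` — an open finite design problem (recorded for ideators; a
solution would make the COARSE crux `∃ lam > 1, …` a two-page theorem, though not the crux itself, whose fineness
is needed by PumpTransfer). With cyclic cancellation every interaction is a triad; a single triad is incompatible
with pure exponentials (for `{X,X,Y}`: rates force `β_Y = 2β_X` and the back-reaction `XY` in `Ẋ` has rate
`3β_X ≠ β_X`; for a distinct triad with catalyst `a`: `β_a = 0`, a steady mode, excluded by `steady_mode_trivial`).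
So every back-reaction monomial must be CANCELLED identically by a monomial of another triad with the same rate sum
and tuned amplitude (codimension-1 conditions on the structure constants, which are ours to choose), while each
mode keeps at least one uncancelled driving monomial of its own rate, and `r_{n+1} ≥ 2r_n` per step. Whether such a
balanced network exists (smallest candidates: m = 3–4, q = lam^{4/5} ∈ {2,3,4}) was not settled this cycle.

(g3) LITERATURE (cycle 2): searchd unavailable (rc 75, degraded); `lit galaxy search --star pdf` bm25 "self-similar
/ ancient solutions of the viscous dyadic–shell model at critical scaling, Liouville" (25 rows): Cheskidov2008
(blow-up α < 1/3), CheskidovShvydkoyFriedlander (continuous cascade model), CampolinaSimonnetThalabard2025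
(non-unique inviscid self-similar blow-ups), stochastic inviscid dyadic stationary measures — nothing on ancient or
Type-I DSS solutions of viscous shell models, no printed counterexample or Liouville theorem for multi-mode
circuits. The negatives index (`ledger negatives`) has no entry touching this crux.
-/

/-!
## (f) The scalar sub-case: what is known (cycle 1, unchanged) — for ideators and the lead

1. POSITIVITY. `scalar_nonneg`: every m = 1 witness is sign-definite, so the m = 1 question is about NON-NEGATIVE
   infinite-energy ancient solutions of the KP chain at β = 5/2 with `λ_BMR = lam^{2/5}`.
2. BMR's INVARIANT REGION KILLS THE POSITIVE SCALAR PUMP AT `λ_BMR = 2` ONLY (paper): Barbato–Morandin–Romito 2011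
   Lemma 2.1 gives a bounded region `A ⊂ ℝ²` (`0 ≤ x ≤ 1`, `h(x) < y < g(x)`), forward invariant for ALL pairs
   `(Y_n, Y_{n+1})`, `Y_n = lam^{(1/5+ε')n}X_n`, for every viscosity `ν ≥ 0` — hence also for the `ν`-rescalings
   `μX(μt)` of a pump. A pump rescaled so that all its pairs at one time lie in `A` (possible: `Y_n → 0` at both ends
   of the chain, all modes strictly positive) would keep `Y_n ≤ 1/μ` forever, while DSS forces
   `sup_n Y_n(lam^{-4k/5}t) = lam^{ε'k} sup_n Y_n(t) → ∞` as `t → 0⁻`. Contradiction — but the lemma is proved for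
   `λ_BMR = 2` (`δ = 1/10, θ = 3/5, m = 3/4`), i.e. lam = 2^{5/2} ≈ 5.66, and its inequality `ψ₂ ≥ 0` FAILS as
   `λ_BMR → 1` (`ψ₂(δ⁺) → δ² − 1/(1−δ) < 0`): for fine lam even finite-energy regularity of the scalar chain is open
   (barrier `DyadicCascadeRegularity`, scope_caveat (ii); CheskidovDaiFriedlander2023 §3.2.1).
3. FINE-LATTICE ASYMPTOTICS (`h := (4/5) log lam → 0`, `ψ := hφ`, `Θ := sψ`; formal): expanding `φ(q s)`,
   `φ(s/q)` in the k = 1 profile equation gives the OUTER law `(1 − 3Θ)ψ' = ψ(1 + ψ/2)` — a transonic first-order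
   equation (the linearised uniform chain `c ≡ 1 + η` has symbol `(cos k − 1) − 3i sin k`: drift speed 3, so the
   characteristic speed at amplitude `Θ` is `3Θ` sites per unit log-time against the DSS frame speed 1). Near
   `s = 0` the flow is SUBSONIC (`Θ → 0` by `typeI_critical_bound`); INNER layers are speed-1 travelling waves of
   the uniform inviscid chain, `Θ'(σ) = Θ(σ)Θ(σ+1) − Θ(σ−1)²`, with the exact Rankine–Hugoniot law
   `½(Θ_l² − Θ_r²) = Θ_l³ − Θ_r³` (energy); the leading front (`Θ_r = 0`) therefore has upstream `Θ_l = 1/2` —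
   SUPERSONIC (`3/2 > 1`), and it exists and is attracting (direct simulation of the uniform chain from a step:
   front speed 2.0005 for unit upstream). Hence a fine-lattice scalar pump must pass from subsonic to supersonic
   strictly inside `(0, s_f)`: a smooth crossing is impossible (source `ψ(1+ψ/2) > 0` on the sonic line) and a
   lattice up-jump `Θ_l < Θ_r` is UNDERCOMPRESSIVE. Unless the advance–delay equation
   `Θ' = ΘΘ(·+1) − Θ(·−1)²` has such non-classical up-jump waves, there is no scalar pump for fine lam. (Open.)
4. DECLOCKING NUMERICS (m = 1; kit j009667; dossier `Cruxes/CircuitPump/ScalarNumericsC1.md`): the exogenously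
   clocked anchor (Tao Prop. 5.1 pair gating, window `(r₂/q, r₂]`) exists iff `r₂ < log q/(4(q−1))`; pseudo-arclength
   continuation in `σ` FOLDS (`q = 2`: `σ* ≈ 0.263` at `r₂ = 0.10`, `0.165` at `0.15`; `q = 1.5`: `≈ 0.18` at `0.12`)
   and returns towards `σ = 0` along an upper branch with amplitude `∝ 1/σ`, whose rescaled limit is an exact
   autonomous decaying FRONT WITHOUT TRAIL (residual `9·10⁻¹⁶` above the window); Newton from it on the closed
   autonomous problem returns to `0` or stalls with sign changes. Reading: decaying fronts of the autonomous scalar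
   equation exist on half-lines; what fails is attaching the frozen trail down to `s = 0⁺` — the transonic
   obstruction of item 3. For the (now not picked) Leray–Schauder line: for m = 1 the a-priori bound along `σ`
   FAILS through a second branch from infinity at `σ = 0⁺`.
-/

/-!
## (d) Reading notes on the picked line `Lines/singular-clock-gspt.lean` (cycle 2) and what (b5)/(a4) say to it

* No stub of the reshaped skeleton is contradicted by anything in this file. `stub_dssExtension` (E) and
  `stub_truncationLimit` (D) are generic and TRUE as typed (drefute report; I concur: E is the rpow bookkeeping of
  `freeX_dss`/`expX_dss`/`dss_up`, D is Arzelà–Ascoli per coordinate).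
* (b5) for `stub_clockBox`/`OnePeriodWitness`: any one-period witness that unrolls (E) to a pump has Type-I
  constant `C ≥ lam^{-1/5}/S_tot(coeff)`; for the intended instances this is automatic (the amplitude window
  `[A⋆/2, 2A⋆]` sits at `A⋆ ≈ log(c/ε)q/(q−1) ≫ 1` in critical units while `S_tot = O(c + ε)`), so (b5) is a
  consistency floor, not a threat: the covering box can never be shrunk towards small data, and `lo ia` must stay
  above the (b5) threshold in Type-I-weighted units — it does by a factor `~A⋆`.
* (a4)/(g1) for the clock picture: the one-period amplitude map of a genuine pump is NOT exactly affine (an exactly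
  affine/linear renormalisation map is what the closed-form exponential solutions realise, and those exist only
  at `lam ≥ 2^{5/4}` and without energy conservation); the drefute numerics (`A' − q(A − M₁,eff) ∈ [−0.20, +0.03]`,
  i.e. affine to < 0.1 %) are consistent with this — the small non-affinity is the spent-bond/environment kick.
* Still valid from cycle 1 (other skeletons): `DeclockingBox` (declocking-continuation S4) asserts uniqueness and
  nondegeneracy of the clocked profile in a tube plus no boundary fixed points along the homotopy — for m = 1 the
  analogous continuation FOLDS (§(f)4); the m = 4 box must exclude that scenario explicitly.
-/

end Summit.NavierStokesRegularity.NavierStokesRegularity.Cruxes.CircuitPump.Disproof
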